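import Summits.QuantumAdvantage.AdviceFreeQNC0.GaugeAverage
import HarnessLib

/-!
# Cell qa-qnc0 (rung F-Q2-odd, `p = 3`): counting the odd class through the gauge (ROUND-15 §3.5, "TRUE side")

Planner qa-qnc0-p1 g16, `ROUND-15.md` §3.5 (formalisation map L5), for THEOREM A′ `PredHardDWB3`.  For a weight
`c ≥ 0` on patterns (later: the indicator of "`g` predicts `D_k`"), the mass of the ODD class is regrouped by
(outside bits `y`, window word `P`):

* `sum_eq_sum_glue` — `Σ_x H(x) = Σ_{y ∈ Y} Σ_w H(glue y w)` (`Y` = patterns vanishing on the window), and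
  `card_Y : #Y · 2^W = 2^{n+1}`;
* `sum_window_eq_sum_blocks` — `Σ_w H(w) = Σ_G Σ_{B : block words G} H(unblk B)`;
* `odd_glue_unblk_iff` — on the fibre of `(y, P)` membership in the odd class is the fixed predicate
  `AdmS y (sgnP P)` (outside zeros + parity of the window zeros, the latter read off from the sign of `P`);
* `sum_perm_eq` — `S₃ = {affP b t}` (sign `b`, translation `t`), so sums over `S₃` split by sign and translation;
* **`sum_odd_le`**: `Σ_{x odd} c(x) ≤ ((2^L+4)/6)^{m+1} · Σ_{y ∈ Y} Σ_{t ∈ 𝔽₃} V c y (affP (εb y) t)` — only the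
  ADMISSIBLE sign `εb y` of the window word survives, and each fibre carries at most `Π_j #fib(G_j) ≤ ((2^L+4)/6)^{m+1}`
  block contents (`DWalkFibres.six_mul_card_fib_le`).

WHAT THIS IS NOT: the structured inputs and Smolensky's bound enter in the next file; separation NOT moved.
-/

noncomputable section

namespace Summit.QuantumAdvantage.AdviceFreeQNC0

namespace DWalk

open Finset Equiv
open Literature.Computability.MetaComplexity Literature.Computability.MetaComplexity.Smolensky

section Count

variable {n : ℕ} {a L m : ℕ} {κ₀ : ZMod 3} {k : ℕ}

/-! ### Regrouping sums -/

/-- **`Σ_x H(x) = Σ_{y ∈ Y} Σ_w H(glue y w)`.** -/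
theorem sum_eq_sum_glue (haW : a + (m + 1) * L ≤ n) (H : (Fin (n + 1) → Bool) → ℝ) :
    ∑ x, H x = ∑ y ∈ Yset a L m, ∑ w : Fin ((m + 1) * L) → Bool, H (glue a L m y w) := by
  rw [← Finset.sum_product (s := Yset a L m) (t := univ) (f := fun p => H (glue a L m p.1 p.2))]
  symm
  refine Finset.sum_bij' (fun p _ => glue a L m p.1 p.2) (fun x _ => (out a L m x, winOf a L m x)) ?_ ?_ ?_ ?_ ?_
  · intro p _; exact mem_univ _
  · intro x _; exact Finset.mem_product.2 ⟨out_mem_Yset x, mem_univ _⟩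
  · rintro ⟨y, w⟩ hp
    have hy : out a L m y = y := mem_Yset.1 (Finset.mem_product.1 hp).1
    simp only [out_glue, hy, winOf_glue haW]
  · intro x _; simp only [glue_out, glue_winOf haW]
  · intro p _; rfl

/-- **`#Y · 2^W = 2^{n+1}`.** -/
theorem card_Yset (haW : a + (m + 1) * L ≤ n) :
    ((Yset (n := n) a L m).card : ℝ) * (2 : ℝ) ^ ((m + 1) * L) = (2 : ℝ) ^ (n + 1) := by
  have h := sum_eq_sum_glue (a := a) (L := L) (m := m) haW (fun _ => (1 : ℝ))
  simp only [sum_const, card_univ, Fintype.card_fun, Fintype.card_bool, Fintype.card_fin, nsmul_eq_mul, mul_one]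
    at h
  push_cast at h
  linarith

/-- **`Σ_w H(w) = Σ_G Σ_{B ∈ BlkSet G} H(unblk B)`.** -/
theorem sum_window_eq_sum_blocks (H : (Fin ((m + 1) * L) → Bool) → ℝ) :
    ∑ w : Fin ((m + 1) * L) → Bool, H w =
      ∑ G : Fin (m + 1) → Perm (ZMod 3), ∑ B ∈ BlkSet L m κ₀ G, H (unblk L m B) := by
  -- window contents as block tuples
  have h1 : ∑ w : Fin ((m + 1) * L) → Bool, H w = ∑ B : Fin (m + 1) → Fin L → Bool, H (unblk L m B) :=
    (Fintype.sum_equiv ⟨unblk L m, wblk L m, wblk_unblk, unblk_wblk⟩ _ _ (fun B => rfl)).symm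
  rw [h1]
  -- each block tuple has exactly one tuple of block words
  symm
  calc ∑ G : Fin (m + 1) → Perm (ZMod 3), ∑ B ∈ BlkSet L m κ₀ G, H (unblk L m B)
      = ∑ G : Fin (m + 1) → Perm (ZMod 3), ∑ B : Fin (m + 1) → Fin L → Bool,
          (if (fun j => blockPerm κ₀ (B j)) = G then H (unblk L m B) else 0) := by
        refine Finset.sum_congr rfl fun G _ => ?_
        rw [BlkSet, Finset.sum_filter]
        refine Finset.sum_congr rfl fun B _ => ?_
        have : (∀ j, blockPerm κ₀ (B j) = G j) ↔ (fun j => blockPerm κ₀ (B j)) = G :=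
          ⟨fun h => funext h, fun h j => congrFun h j⟩
        simp only [this]
    _ = ∑ B : Fin (m + 1) → Fin L → Bool, H (unblk L m B) := by
        rw [Finset.sum_comm]
        refine Finset.sum_congr rfl fun B _ => ?_
        rw [Finset.sum_ite_eq univ (fun j => blockPerm κ₀ (B j)) (fun _ => H (unblk L m B))]
        simp

/-! ### Signs and the odd class on a fibre -/

/-- On the fibre of `(y, G)` the window sign is the sign of the product `G_0 ⋯ G_m`. -/
theorem sgnW_glue_unblk (hκ : KappaConst a L m κ₀ k) (haW : a + (m + 1) * L ≤ n) (y : Fin (n + 1) → Bool)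
    {G : Fin (m + 1) → Perm (ZMod 3)} {B : Fin (m + 1) → Fin L → Bool} (hB : B ∈ BlkSet L m κ₀ G) :
    sgnW (xN (glue a L m y (unblk L m B))) a ((m + 1) * L) = sgnP (Fin.partialProd G (Fin.last (m + 1))) := by
  have i1 := isAff_wp (kappa k) (xN (glue a L m y (unblk L m B))) a ((m + 1) * L)
  rw [← Pwin_eq_wp hκ] at i1
  have hG : Gblk a L m κ₀ (glue a L m y (unblk L m B)) = G := by
    funext j; rw [Gblk_glue_unblk haW]; exact (mem_BlkSet.1 hB) j
  unfold Pwin at i1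
  rw [hG] at i1
  exact (sgnP_of_isAff i1).symm

/-- Outside zeros do not depend on the window content. -/
theorem zerosOut_glue (y : Fin (n + 1) → Bool) (w : Fin ((m + 1) * L) → Bool) :
    zerosOut a L m (glue a L m y w) = zerosOut a L m y := by
  unfold zerosOut
  congr 1; ext j
  simp only [mem_filter, mem_univ, true_and]
  constructor
  · rintro ⟨h, hx⟩; exact ⟨h, by rw [glue_apply_of_not_mem y w h] at hx; exact hx⟩
  · rintro ⟨h, hx⟩; exact ⟨h, by rw [glue_apply_of_not_mem y w h]; exact hx⟩

/-- **On the fibre of `(y, P)` the odd class is the predicate `AdmS y (sgnP P)`.** -/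
theorem odd_glue_unblk_iff (hκ : KappaConst a L m κ₀ k) (haW : a + (m + 1) * L ≤ n) (y : Fin (n + 1) → Bool)
    {G : Fin (m + 1) → Perm (ZMod 3)} {B : Fin (m + 1) → Fin L → Bool} (hB : B ∈ BlkSet L m κ₀ G) :
    (univ.filter fun j : Fin (n + 1) => glue a L m y (unblk L m B) j = false).card % 2 = 1 ↔
      AdmS a L m y (sgnP (Fin.partialProd G (Fin.last (m + 1)))) := by
  have key : ∀ A Z : ℕ, ((A + Z) % 2 = 1 ↔
      (A + (if ((if Z % 2 = 0 then (1 : ZMod 3) else -1) = 1) then 0 else 1)) % 2 = 1) := by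
    intro A Z
    rcases Nat.mod_two_eq_zero_or_one Z with hZ | hZ
    · rw [if_pos hZ, if_pos rfl]; omega
    · rw [if_neg (show ¬ (Z % 2 = 0) by omega), if_neg (show ¬ ((-1 : ZMod 3) = 1) by decide)]; omega
  rw [card_zeros_eq haW, ← sgnW_glue_unblk hκ haW y hB, sgnW_eq_ite]
  have hz : (univ.filter fun j : Fin (n + 1) => ¬ (a ≤ j.val ∧ j.val < a + (m + 1) * L) ∧
      glue a L m y (unblk L m B) j = false).card = zerosOut a L m y := zerosOut_glue y (unblk L m B)
  rw [hz]
  exact key _ _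

/-! ### Summing over `S₃` by sign and translation -/

/-- Every permutation of `𝔽₃` is some `affP b t`. -/
theorem affP_surjective (P : Perm (ZMod 3)) : ∃ b t, affP b t = P := by
  obtain ⟨hP, he⟩ := perm_isAff P
  refine ⟨decide (P 1 - P 0 = 1), P 0, ?_⟩
  refine (isAff_affP _ _).perm_eq ?_
  rcases he with h | h
  · simp only [h, decide_true]; exact (show yt true = 1 from rfl) ▸ h ▸ hP
  · have hne : ¬ (P 1 - P 0 = 1) := by rw [h]; decide
    simp only [hne, decide_false]; exact (show yt false = -1 from rfl) ▸ h ▸ hP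

/-- `(b, t) ↦ affP b t` is injective. -/
theorem affP_injective : Function.Injective fun p : Bool × ZMod 3 => affP p.1 p.2 := by
  rintro ⟨b, t⟩ ⟨b', t'⟩ h
  have h' : affP b t = affP b' t' := h
  have i2 : IsAff (affP b t) (yt b') t' := by rw [h']; exact isAff_affP b' t'
  have hu := (isAff_affP b t).unique i2
  have hb : b = b' := by
    rcases hu with ⟨h1, _⟩
    revert h1; cases b <;> cases b' <;> decide
  rw [hb, hu.2]

/-- **Sums over `S₃` split by sign and translation.** -/
theorem sum_perm_eq (f : Perm (ZMod 3) → ℝ) :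
    ∑ P : Perm (ZMod 3), f P = ∑ b : Bool, ∑ t : ZMod 3, f (affP b t) := by
  rw [← Fintype.sum_prod_type']
  exact (Fintype.sum_equiv (Equiv.ofBijective (fun p : Bool × ZMod 3 => affP p.1 p.2)
    ⟨affP_injective, fun P => by obtain ⟨b, t, h⟩ := affP_surjective P; exact ⟨(b, t), h⟩⟩) _ _ (fun p => rfl)).symm

/-- `AdmS y (yt b) ↔ b = εb y`. -/
theorem admS_yt_iff (y : Fin (n + 1) → Bool) (b : Bool) : AdmS a L m y (yt b) ↔ b = εb a L m y := by
  unfold AdmS εb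
  cases b
  · simp only [show ((yt false : ZMod 3) = 1) ↔ False by decide, if_false, Bool.false_eq, decide_eq_false_iff_not]
    omega
  · simp only [show yt true = (1 : ZMod 3) from rfl, if_true, Nat.add_zero, Bool.true_eq, decide_eq_true_iff]

/-! ### The TRUE-side inequality -/

/-- Product of fibre sizes: `Π_j #fib(G_j) ≤ ((2^L+4)/6)^{m+1}`. -/
theorem prod_card_fib_le (hκ0 : κ₀ ≠ 0) (hL : 1 ≤ L) (G : Fin (m + 1) → Perm (ZMod 3)) :
    ∏ j, ((fib κ₀ L (G j)).card : ℝ) ≤ (((2 : ℝ) ^ L + 4) / 6) ^ (m + 1) := by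
  calc ∏ j, ((fib κ₀ L (G j)).card : ℝ) ≤ ∏ _j : Fin (m + 1), (((2 : ℝ) ^ L + 4) / 6) := by
        refine Finset.prod_le_prod (fun j _ => by positivity) fun j _ => ?_
        have h := six_mul_card_fib_le hκ0 hL (G j)
        have h' : (6 : ℝ) * ((fib κ₀ L (G j)).card : ℝ) ≤ (2 : ℝ) ^ L + 4 := by exact_mod_cast h
        linarith
    _ = (((2 : ℝ) ^ L + 4) / 6) ^ (m + 1) := by
        rw [Finset.prod_const, Finset.card_univ, Fintype.card_fin]

/-- **TRUE side** (ROUND-15 §3.5): for `c ≥ 0`,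
`Σ_{x odd} c(x) ≤ ((2^L+4)/6)^{m+1} · Σ_{y ∈ Y} Σ_t V c y (affP (εb y) t)`. -/
theorem sum_odd_le (hκ0 : κ₀ ≠ 0) (hκ : KappaConst a L m κ₀ k) (haW : a + (m + 1) * L ≤ n) (hL : 3 ≤ L)
    (c : (Fin (n + 1) → Bool) → ℝ) (hc : ∀ x, 0 ≤ c x) :
    ∑ x : Fin (n + 1) → Bool, (if (univ.filter fun j : Fin (n + 1) => x j = false).card % 2 = 1 then c x else 0) ≤
      (((2 : ℝ) ^ L + 4) / 6) ^ (m + 1) *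
        ∑ y ∈ Yset a L m, ∑ t : ZMod 3, Vsum a L m κ₀ c y (affP (εb a L m y) t) := by
  rw [sum_eq_sum_glue haW, Finset.mul_sum]
  refine Finset.sum_le_sum fun y _ => ?_
  rw [sum_window_eq_sum_blocks (κ₀ := κ₀)]
  -- on each fibre the odd-class indicator is constant
  have hfib : ∀ G : Fin (m + 1) → Perm (ZMod 3),
      ∑ B ∈ BlkSet L m κ₀ G, (if (univ.filter fun j : Fin (n + 1) => glue a L m y (unblk L m B) j = false).card
        % 2 = 1 then c (glue a L m y (unblk L m B)) else 0) =
      (if AdmS a L m y (sgnP (Fin.partialProd G (Fin.last (m + 1)))) then 1 else 0) *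
        ((∏ j, ((fib κ₀ L (G j)).card : ℝ)) * avgB a L m κ₀ c y G) := by
    intro G
    have hprod : (0 : ℝ) < ∏ j, ((fib κ₀ L (G j)).card : ℝ) :=
      Finset.prod_pos fun j _ => by exact_mod_cast (fib_nonempty hκ0 hL (G j)).card_pos
    unfold avgB
    rw [mul_div_cancel₀ _ hprod.ne']
    by_cases hA : AdmS a L m y (sgnP (Fin.partialProd G (Fin.last (m + 1))))
    · rw [if_pos hA, one_mul]
      refine Finset.sum_congr rfl fun B hB => ?_
      rw [if_pos ((odd_glue_unblk_iff hκ haW y hB).2 hA)]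
    · rw [if_neg hA, zero_mul]
      refine Finset.sum_eq_zero fun B hB => ?_
      rw [if_neg (fun h => hA ((odd_glue_unblk_iff hκ haW y hB).1 h))]
  simp only [hfib]
  -- bound the fibre sizes, regroup by the window word, keep the admissible sign
  calc ∑ G : Fin (m + 1) → Perm (ZMod 3),
        (if AdmS a L m y (sgnP (Fin.partialProd G (Fin.last (m + 1)))) then (1 : ℝ) else 0) *
          ((∏ j, ((fib κ₀ L (G j)).card : ℝ)) * avgB a L m κ₀ c y G)
      ≤ ∑ G : Fin (m + 1) → Perm (ZMod 3),
        (if AdmS a L m y (sgnP (Fin.partialProd G (Fin.last (m + 1)))) then (1 : ℝ) else 0) *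
          ((((2 : ℝ) ^ L + 4) / 6) ^ (m + 1) * avgB a L m κ₀ c y G) := by
        refine Finset.sum_le_sum fun G _ => mul_le_mul_of_nonneg_left ?_ (by split_ifs <;> norm_num)
        exact mul_le_mul_of_nonneg_right (prod_card_fib_le hκ0 (by omega) G) (avgB_nonneg hc y G)
    _ = (((2 : ℝ) ^ L + 4) / 6) ^ (m + 1) * ∑ P : Perm (ZMod 3),
          (if AdmS a L m y (sgnP P) then (1 : ℝ) else 0) * Vsum a L m κ₀ c y P := by
        rw [Finset.mul_sum]
        unfold Vsum
        rw [← Finset.sum_fiberwise univ (fun G : Fin (m + 1) → Perm (ZMod 3) => Fin.partialProd G (Fin.last (m + 1)))]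
        refine Finset.sum_congr rfl fun P _ => ?_
        rw [Finset.mul_sum, Finset.mul_sum]
        unfold Fib
        refine Finset.sum_congr rfl fun G hG => ?_
        rw [(Finset.mem_filter.1 hG).2]; ring
    _ = (((2 : ℝ) ^ L + 4) / 6) ^ (m + 1) * ∑ t : ZMod 3, Vsum a L m κ₀ c y (affP (εb a L m y) t) := by
        congr 1
        rw [sum_perm_eq, Fintype.sum_bool]
        simp only [sgnP_affP, admS_yt_iff]
        cases εb a L m y <;> simp

end Count

end DWalk

end Summit.QuantumAdvantage.AdviceFreeQNC0

end
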